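import Mathlib
import Summits.Ventures.PercRepro.TriangleCapFourBelowTwelve

/-!
# PercRepro — FOUR BELOW THE DIAGONAL AT `k = 11`: THREE TRIANGLES WITH ONE SHARED VERTEX (p3, gen 39; part 142)

Two triangles through `t` and a third, disjoint, triangle `T₃`: the transversal pairs lie in `{t} × T₃ ∪ T₃ × {t}`
(part 125), and at most ONE vertex of `T₃` is a transversal partner of `t` in each order — two partners `z ≠ z′`
of `T₃` are adjacent (`T₃` is a triangle), so `z′` is a common neighbour of `t` and `z`, against `codeg = 0`.
Hence `|F| ≤ 2` (`transversal_card_le_of_one_shared`) and the crude count closes for `k ≥ 11`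
(`three_triangles_stability_four_of_one_shared_of_eleven`).  Axioms: standard.
-/

namespace PercRepro

namespace TriangleCap

namespace C047

open Finset

variable {V : Type*} [Fintype V] [DecidableEq V]

/-- **AT MOST ONE TRANSVERSAL PARTNER OF `t` IN THE DISJOINT TRIANGLE, IN EACH ORDER.** -/
theorem transversal_card_le_of_one_shared (D : SimpleGraph V) [DecidableRel D.Adj] (hK : K4mFree D)
    (T₁ T₂ T₃ : Finset V) (h₁ : T₁.card = 3) (h₂ : T₂.card = 3) (h₃ : T₃.card = 3) {t : V}
    (h12 : T₁ ∩ T₂ = {t}) (h13 : Disjoint T₁ T₃) (h23 : Disjoint T₂ T₃)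
    (hcl₁ : ∀ x ∈ T₁, ∀ y ∈ T₁, x ≠ y → D.Adj x y) (hcl₂ : ∀ x ∈ T₂, ∀ y ∈ T₂, x ≠ y → D.Adj x y)
    (hcl₃ : ∀ x ∈ T₃, ∀ y ∈ T₃, x ≠ y → D.Adj x y) :
    ((adjPairsAll D).filter (fun p => codeg D p = 0 ∧ deficit D p = 0)).card ≤ 2 := by
  have hF := transversal_subset_of_one_shared D hK T₁ T₂ T₃ h₁ h₂ h₃ h12 h13 h23 hcl₁ hcl₂ hcl₃
  set F : Finset (V × V) := (adjPairsAll D).filter (fun p => codeg D p = 0 ∧ deficit D p = 0) with hFdef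
  set Z₁ : Finset V := T₃.filter (fun z => (t, z) ∈ F) with hZ₁
  set Z₂ : Finset V := T₃.filter (fun z => (z, t) ∈ F) with hZ₂
  have hFZ : F ⊆ ({t} ×ˢ Z₁) ∪ (Z₂ ×ˢ {t}) := by
    intro p hp
    have hp' := hF hp
    rw [mem_union, mem_product, mem_product, mem_singleton, mem_singleton] at hp'
    rw [mem_union, mem_product, mem_product, mem_singleton, mem_singleton]
    rcases hp' with ⟨h1, h2⟩ | ⟨h1, h2⟩
    · left
      refine ⟨h1, ?_⟩
      rw [hZ₁, mem_filter]
      refine ⟨h2, ?_⟩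
      have : p = (t, p.2) := by rw [← h1]
      rw [← this]; exact hp
    · right
      refine ⟨?_, h2⟩
      rw [hZ₂, mem_filter]
      refine ⟨h1, ?_⟩
      have : p = (p.1, t) := by rw [← h2]
      rw [← this]; exact hp
  -- two partners in `T₃` would be adjacent: a common neighbour of `t` and the first
  have hadjF : ∀ z, (t, z) ∈ F → D.Adj t z ∧ codeg D (t, z) = 0 := by
    intro z hz
    rw [hFdef, mem_filter] at hz
    unfold adjPairsAll at hz
    rw [mem_filter] at hz
    exact ⟨hz.1.2, hz.2.1⟩
  have hadjF' : ∀ z, (z, t) ∈ F → D.Adj t z ∧ codeg D (t, z) = 0 := by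
    intro z hz
    rw [hFdef, mem_filter] at hz
    unfold adjPairsAll at hz
    rw [mem_filter] at hz
    refine ⟨hz.1.2.symm, ?_⟩
    have hc := hz.2.1
    unfold codeg at hc ⊢
    rw [card_eq_zero, filter_eq_empty_iff] at hc ⊢
    intro x hx hxx
    exact hc hx ⟨hxx.2, hxx.1⟩
  have hone : ∀ z ∈ T₃, ∀ z' ∈ T₃, D.Adj t z → codeg D (t, z) = 0 → D.Adj t z' → z = z' := by
    intro z hz z' hz' htz hcod htz'
    by_contra hne
    have hzz' := hcl₃ z hz z' hz' hne
    unfold codeg at hcod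
    rw [card_eq_zero, filter_eq_empty_iff] at hcod
    exact hcod (mem_univ z') ⟨htz', hzz'⟩
  have hZ₁c : Z₁.card ≤ 1 := by
    rw [card_le_one]
    intro z hz z' hz'
    rw [hZ₁, mem_filter] at hz hz'
    obtain ⟨h1, h2⟩ := hadjF z hz.2
    exact hone z hz.1 z' hz'.1 h1 h2 (hadjF z' hz'.2).1
  have hZ₂c : Z₂.card ≤ 1 := by
    rw [card_le_one]
    intro z hz z' hz'
    rw [hZ₂, mem_filter] at hz hz'
    obtain ⟨h1, h2⟩ := hadjF' z hz.2
    exact hone z hz.1 z' hz'.1 h1 h2 (hadjF' z' hz'.2).1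
  calc F.card ≤ (({t} ×ˢ Z₁) ∪ (Z₂ ×ˢ {t})).card := card_le_card hFZ
    _ ≤ ({t} ×ˢ Z₁).card + (Z₂ ×ˢ {t}).card := card_union_le _ _
    _ = Z₁.card + Z₂.card := by rw [card_product, card_product, card_singleton, one_mul, mul_one]
    _ ≤ 2 := by omega

/-- **FOUR BELOW THE DIAGONAL, THREE TRIANGLES WITH ONE SHARED VERTEX, `k ≥ 11`.** -/
theorem three_triangles_stability_four_of_one_shared_of_eleven (D : SimpleGraph V) [DecidableRel D.Adj]
    (hK : K4mFree D) (hk : 11 ≤ Fintype.card V) (hm : 6 * Fintype.card V ≤ 2 * D.edgeFinset.card + 26)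
    (T₁ T₂ T₃ : Finset V) (h₁ : T₁.card = 3) (h₂ : T₂.card = 3) (h₃ : T₃.card = 3) {t : V}
    (h12 : T₁ ∩ T₂ = {t}) (h13 : Disjoint T₁ T₃) (h23 : Disjoint T₂ T₃)
    (hcl₁ : ∀ x ∈ T₁, ∀ y ∈ T₁, x ≠ y → D.Adj x y) (hcl₂ : ∀ x ∈ T₂, ∀ y ∈ T₂, x ≠ y → D.Adj x y)
    (hcl₃ : ∀ x ∈ T₃, ∀ y ∈ T₃, x ≠ y → D.Adj x y)
    (hT : ∀ x y z, D.Adj x y → D.Adj x z → D.Adj y z →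
      (x ∈ T₁ ∧ y ∈ T₁) ∨ (x ∈ T₂ ∧ y ∈ T₂) ∨ (x ∈ T₃ ∧ y ∈ T₃)) :
    ∑ v, deg D v * deg D v + 4 * (Fintype.card V - 5) ≤ D.edgeFinset.card * Fintype.card V := by
  have hi12 : (T₁ ∩ T₂).card ≤ 1 := by rw [h12, card_singleton]
  have hi13 : (T₁ ∩ T₃).card ≤ 1 := by rw [disjoint_iff_inter_eq_empty.mp h13, card_empty]; exact Nat.zero_le _
  have hi23 : (T₂ ∩ T₃).card ≤ 1 := by rw [disjoint_iff_inter_eq_empty.mp h23, card_empty]; exact Nat.zero_le _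
  have hT3 := card_triangles3_eq_eighteen D hK T₁ T₂ T₃ h₁ h₂ h₃ hcl₁ hcl₂ hcl₃ (ne_of_inter_card_le_one h₁ hi12)
    (ne_of_inter_card_le_one h₁ hi13) (ne_of_inter_card_le_one h₂ hi23) hT
  have hFc := transversal_card_le_of_one_shared D hK T₁ T₂ T₃ h₁ h₂ h₃ h12 h13 h23 hcl₁ hcl₂ hcl₃
  apply stability_four_of_transversal D hK (by omega) 3 hT3
  omega

end C047

end TriangleCap

end PercRepro
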